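import Summits.QuantumFields.BalabanUV.T4Continuum.Support.ShellMeasureDecayRowsModelEnd
import Summits.QuantumFields.BalabanUV.T4Continuum.Support.ShellMeasureDecayComplexRayCells

/-!
# `T4Continuum.ShellMeasureDecayRowsModelEndComplexRay` — ROW S124 = J-END, COMPANION «THE COMPLEX-RAY TWIN» (owner R-ne7cp1-g37-13 (b):
# «+ the complex-ray twin from S121 (first-order budget) as a second theorem in the same file or a companion»): (E6)∕(E1) for the cell
# blocks of `(cmat levelOp + P)⁻¹` — the block-sectioned MODEL operator on the slot's own two-level cube family, COMPLEXIFIED along the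
# contraction ray by a re-nonnegative remainder `P` under S121's sitewise first-order budget — from IN-CELL PLAQUETTE-SMALLNESS of the
# (real) background alone; every J-file consumed BY NAME
(cell `pub-balaban`, sub-cell `t4`, spine estimate NE7c (node U5b); NE7c ROUND-2 crew `t4-ne7c-formalise-*`, unit
`b2b-balaban-t4-ne7c-formalise-leaf-02` gen 14; owner table ROW **S124 = J-END** (R-ne7cp1-g37-13 (b), journal l.24616; MINE l.24657);
ADDITIVE — imports this row's f1 `ShellMeasureDecayRowsModelEnd` (hence S119 f1∕f3, J3 f1∕f2, S117, S66 f3a, `Beta/MultiscaleGrowthCells`)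
and S121 = J6 f4 `ShellMeasureDecayComplexRayCells` (leaf-10-g15, p244131: `cellNorm_inv_add_complexRay_le`; hence S121 f1
`ShellMeasureDecayComplexRay`) ONLY, everything BY NAME; touches NO host, moves NO census row; [folklore]; 0 `def`, 0 `def … : Prop`,
0 sorry, 0 citation tags of Bałaban's.)

HONEST FRAMING.  Finite four-torus programme, rung (B)+1 only — NOT infinite volume, NOT a mass gap, NOT the Clay problem, NOT summit
progress; (B), `BetaPertHyp`, (B^μ) not consumed and NOT discharged.  NE7c (`T4IndicatorShell.ShellWeightBound`) is NOT PRINTED in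
[Balaban 1983–89] and NOT PROVED; «NE7c ⇐ the named binders» (trigger c3).  WHAT THIS IS ∕ IS NOT (R-ne7cp1-g37-13 (c)): E6∕E1 for a MODEL
operator of [B9] (3.24) SHAPE, complexified by an ABSTRACT re-nonnegative remainder `P` whose sitewise exponential row∕column defect obeys
S121's first-order budget `θ·μ₀·n⁻²` (J1 (D7): the anti-Hermitian part of a complexified covariant background has entries `O(α₁∕S_j)`, one
power of `S_j⁻¹` better than the Hermitian part — the regime of `AccretiveCombesThomasBudget.conjLower_of_expDefect`); `P`, `hP`, `θ`, `hJ`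
are DISPLAYED — nothing says WHICH `P` Bałaban's contraction ray produces (node O ∕ a later junction); NOT E1∕E6 for Bałaban's
`𝒢 = (Δ₁ + D*RD + aQ*Q)⁻¹`, `H₁`, `H`; ℓ²-fibre reading; no ONE CALL row moves; nothing of Bałaban's instantiated, asserted, cited or
discharged; census COUNT unchanged.  HONEST DEPENDENCY (cell): continuum YM on T⁴ ⇐ BetaPertH ∧ nine spine estimates (0/9 proved);
BetaPertH ⇐ (D1) ∧ (D4) ∧ CAP+tail; G-an2-4 gates asym, D1 and NE2/3/4.

CONTENT (kernel).
* §1 (generic, Mathlib only) **`opNorm_toEuclideanCLM_block_le_of_sqrt`**: a COMPLEX matrix `A` with the two-set bound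
  `√(Σ_{p∈Xc}‖(A v)_p‖²) ≤ B·√(Σ_{q∈Xb}‖v_q‖²)` for `v` supported in `Xb` (`B ≥ 0`) has the block `toEuclideanCLM (of fun p q =>
  [p ∈ Xc][q ∈ Xb]·A p q)` of operator norm `≤ B` on `EuclideanSpace ℂ X` (J3 f1's `opNorm_block_le` without the complexification step).
* §2 **(E6, complex ray) `decayRow_complexRay_slot_of_plaquettes`** = S121 f4 `cellNorm_inv_add_complexRay_le` BY NAME on S117's family
  with the contour transports as level transports and the cell-sum coercivity SUPPLIED from E7's plaquette letters through S119 f1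
  (`multiscale_coercive_torus_cov` at `cellGauge ∕ cellGauge_orth ∕ hgauge_of_plaquettes ∕ hloss_of_plaquettes`, as S119 f3 ∕ J3 f1 `_cov`):
  for ALL cells `c b′`, `‖blockP c b′‖ ≤ (e^{4dκ}(L·s)²∕((1−θ)μ₀))·exp(−(κ·sdist (corner c) (corner b′)))`, `μ₀` = f1's.
* §3 **(E1, complex ray) `opNorm_kerOp_complexRay_slot_of_plaquettes`**: `‖kerOp blockP‖ ≤ (e^{4dκ}(L·s)²∕((1−θ)μ₀))·N₀Λ∕(1 − Λe^{−κ})`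
  — f1's `rowSum_sdist_slot` + S66 f3a `opNorm_kerOp_le` BY NAME; **`norm_kerOp_complexRay_slot_apply_le`**: the host's POINTWISE shape
  `∀ f, ‖kerOp blockP f‖ ≤ B₀·‖f‖`.  NORMALISATION as in f1 (the `(L·s)²` local prefactor; node O's item).
* §4 RULE G-1: both ENDs FIRE on f1's `d = 4` family, flat background, ZERO remainder (`P = 0`, `θ = 0`) — every hypothesis discharged.
-/

noncomputable section

open scoped BigOperators Matrix Matrix.Norms.L2Operator ComplexConjugate
open Finset Function

namespace Summit.QuantumFields.BalabanUV.T4Continuum.ShellMeasureDecayRowsModelEndComplexRay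

/-! ## §1 The two-set block of a complex matrix on `EuclideanSpace ℂ X` -/

section Block

variable {X : Type*} [Fintype X] [DecidableEq X]

/-- the two-set block kernel `[p ∈ Xc][q ∈ Xb]·A p q` acts as `x ↦ 1_{Xc}·A(1_{Xb}·x)`. [folklore] -/
theorem mulVec_block_eq (A : Matrix X X ℂ) (Xc Xb : Finset X) (x : X → ℂ) (p : X) :
    ((Matrix.of fun p q => if p ∈ Xc ∧ q ∈ Xb then A p q else 0) *ᵥ x) p =
      if p ∈ Xc then (A *ᵥ fun q => if q ∈ Xb then x q else 0) p else 0 := by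
  simp only [Matrix.mulVec, dotProduct, Matrix.of_apply]
  by_cases hp : p ∈ Xc
  · rw [if_pos hp]
    refine sum_congr rfl fun q _ => ?_
    by_cases hq : q ∈ Xb
    · rw [if_pos ⟨hp, hq⟩, if_pos hq]
    · rw [if_neg (fun h => hq h.2), if_neg hq, zero_mul, mul_zero]
  · rw [if_neg hp]
    exact sum_eq_zero fun q _ => by rw [if_neg (fun h => hp h.1), zero_mul]

/-- **The two-set block bound, complex form.**  `√(Σ_{p∈Xc}‖(A v)_p‖²) ≤ B·√(Σ_{q∈Xb}‖v_q‖²)` for every `v` supported in `Xb` (`B ≥ 0`)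
⟹ `‖toEuclideanCLM (of fun p q => [p ∈ Xc][q ∈ Xb]·A p q)‖ ≤ B`. [folklore] -/
theorem opNorm_toEuclideanCLM_block_le_of_sqrt (A : Matrix X X ℂ) (Xc Xb : Finset X) {B : ℝ} (hB : 0 ≤ B)
    (hA : ∀ v : X → ℂ, (∀ q, q ∉ Xb → v q = 0) →
      Real.sqrt (∑ p ∈ Xc, ‖(A *ᵥ v) p‖ ^ 2) ≤ B * Real.sqrt (∑ q ∈ Xb, ‖v q‖ ^ 2)) :
    ‖Matrix.toEuclideanCLM (n := X) (𝕜 := ℂ) (Matrix.of fun p q => if p ∈ Xc ∧ q ∈ Xb then A p q else 0)‖ ≤ B := by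
  set M : Matrix X X ℂ := Matrix.of fun p q => if p ∈ Xc ∧ q ∈ Xb then A p q else 0 with hM
  set T := Matrix.toEuclideanCLM (n := X) (𝕜 := ℂ) M with hT
  refine T.opNorm_le_bound hB fun w => ?_
  set v : X → ℂ := fun q => if q ∈ Xb then w q else 0 with hv
  have hv0 : ∀ q, q ∉ Xb → v q = 0 := fun q hq => by simp [hv, hq]
  have hcoord : ∀ p, (T w) p = (M *ᵥ fun q => w q) p := fun p =>
    congrFun (Matrix.ofLp_toEuclideanCLM (n := X) (𝕜 := ℂ) M w) p
  -- `‖T w‖² = Σ_{p∈Xc} ‖(A v)_p‖²`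
  have h1 : ‖T w‖ ^ 2 = ∑ p ∈ Xc, ‖(A *ᵥ v) p‖ ^ 2 := by
    rw [EuclideanSpace.norm_sq_eq]
    simp_rw [hcoord, hM, mulVec_block_eq A Xc Xb]
    rw [← sum_filter_add_sum_filter_not univ (fun p => p ∈ Xc)]
    have hz : ∑ p ∈ univ.filter (fun p => ¬ p ∈ Xc),
        ‖(if p ∈ Xc then (A *ᵥ fun q => if q ∈ Xb then w q else 0) p else 0)‖ ^ 2 = 0 :=
      sum_eq_zero fun p hp => by rw [if_neg (mem_filter.mp hp).2, norm_zero]; ring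
    rw [hz, add_zero]
    have hs : univ.filter (fun p => p ∈ Xc) = Xc := by ext p; simp
    rw [hs]
    exact sum_congr rfl fun p hp => by rw [if_pos hp]
  -- `Σ_{q∈Xb} ‖v_q‖² ≤ ‖w‖²`
  have h2 : ∑ q ∈ Xb, ‖v q‖ ^ 2 ≤ ‖w‖ ^ 2 := by
    rw [EuclideanSpace.norm_sq_eq]
    calc ∑ q ∈ Xb, ‖v q‖ ^ 2 = ∑ q ∈ Xb, ‖w q‖ ^ 2 := sum_congr rfl fun q hq => by simp [hv, hq]
      _ ≤ ∑ q, ‖w q‖ ^ 2 := sum_le_univ_sum_of_nonneg fun q => sq_nonneg _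
  have h3 : Real.sqrt (‖T w‖ ^ 2) ≤ B * Real.sqrt (‖w‖ ^ 2) := by
    rw [h1]
    exact (hA v hv0).trans (mul_le_mul_of_nonneg_left (Real.sqrt_le_sqrt h2) hB)
  rwa [Real.sqrt_sq (norm_nonneg _), Real.sqrt_sq (norm_nonneg _)] at h3

end Block

/-! ## §2 (E6) along the complex ray, on the slot family, from in-cell plaquette-smallness -/

section Slot

open Summit.QuantumFields.BalabanUV.Beta
open Summit.QuantumFields.BalabanUV.Beta.BoxPoincare (Box)
open Summit.QuantumFields.BalabanUV.Beta.CovariantBoxPoincare (hol succ)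
open Summit.QuantumFields.BalabanUV.Beta.MultiscaleCoerciveTorus
open Summit.QuantumFields.BalabanUV.Beta.MultiscaleDecayBudget (siteScale cellOf)
open Summit.QuantumFields.BalabanUV.Beta.MultiscaleDistance (sdist sdist_nonneg)
open Summit.QuantumFields.BalabanUV.Beta.MultiscaleCoerciveTorusCov (multiscale_coercive_torus_cov)
open Summit.QuantumFields.BalabanUV.Beta.AccretiveCombesThomasBudget (expRowDefect expColDefect)
open Summit.QuantumFields.BalabanUV.Beta.CovariantTowerMatrix (cmat)
open Summit.QuantumFields.BalabanUV.Beta.ThinLoopHolonomy (cpxHom)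
open Summit.QuantumFields.BalabanUV.T4Continuum.ShellMeasureSlotCubeFamily
open Summit.QuantumFields.BalabanUV.T4Continuum.ShellMeasureDecayRowsLevelOpCellsSlot (side_le_coarse)
open Summit.QuantumFields.BalabanUV.T4Continuum.ShellMeasureCellGaugeFromPlaquettes
  (cellPlaq cellGauge cellGauge_orth hgauge_of_plaquettes hloss_of_plaquettes)
open Summit.QuantumFields.BalabanUV.T4Continuum.ShellMeasureDecayComplexRayCells (cellNorm_inv_add_complexRay_le)
open Summit.QuantumFields.BalabanUV.T4Continuum.ShellMeasureDecayRowsModelEnd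
  (rowSum_sdist_slot mu0_pos_d4 rate_d4 norm_cellPlaq_flat_sub_one)
open Summit.QuantumFields.BalabanUV.T4Continuum.ShellMeasureDecayKernelSums (kerOp opNorm_kerOp_le)
open Literature.MathematicalPhysics.QuantumFieldTheory.Balaban1983to89
open Literature.MathematicalPhysics.QuantumFieldTheory.Balaban1983to89.B9Thm37GluePU (bsrc btgt)
open Literature.MathematicalPhysics.QuantumFieldTheory.Balaban1983to89.B9Thm37GlueTorusCov (tblk torusComb)
open Literature.MathematicalPhysics.QuantumFieldTheory.Balaban1983to89.B9Thm37GlueTorusCovLevels (levelOp)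
open B5TorusCover (UT Ctr ctrU nC)

variable {d : ℕ} [NeZero d] {N : Fin d → ℕ} [∀ i, NeZero (N i)] {Cp : Type} [Fintype Cp] [DecidableEq Cp] [Nonempty Cp]
variable {s L : ℕ} {Λ : Finset (Ctr N (L * s))} (hs : 1 ≤ s) (hL : 1 ≤ L) (hdiv : ∀ i, L * s ∣ N i)

/-- **(E6) ALONG THE COMPLEX RAY ON THE SLOT's OWN GEOMETRY, FROM E7's LITERAL SHAPE** (S121 f4 `cellNorm_inv_add_complexRay_le` BY NAME on
S117's family — `cells_disjoint cells_cover meanProfile_supp scale_lo scale_hi`, contour transports, `S_max := L·s` — with the cell-sum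
coercivity `(1 − 8d⁴α₀²)·min(c_min²∕(4d), a_min∕4)` SUPPLIED by `multiscale_coercive_torus_cov` at S119 f1's designed gauge; then §1):
for column-orthonormal `Rm`, `0 < c_min ≤ |c_b| ≤ c_max`, `0 ≤ a_min ≤ α_l ≤ a_max`, in-cell plaquette sizes `α_k ≥ 0` with `S_k²·α_k ≤ α₀`
and `‖plaquette − 1‖ ≤ α_k`, a rate `κ ∈ [0,1]` with `μ₀ > 0`, a complex remainder `P` with `Re z^*Pz ≥ 0` and the sitewise budget
`½(expRowDefect + expColDefect)(P; κ, sdist(·, q)) ≤ θ·μ₀·n⁻²` (`θ < 1`), and ALL cells `c b′`: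
`‖blockP c b′‖ ≤ (e^{4dκ}(L·s)²∕((1−θ)μ₀))·exp(−(κ·sdist (corner c) (corner b′)))`. [folklore] -/
theorem decayRow_complexRay_slot_of_plaquettes
    (Rm : UT N × Fin d → Cp → Cp → ℝ) (hRm : ∀ b i j, ∑ k, Rm b k i * Rm b k j = if i = j then (1 : ℝ) else 0)
    {acoef : Bool → ℝ} {amin amax : ℝ} (hamin : 0 ≤ amin) (ha_lo : ∀ l, amin ≤ acoef l) (ha_hi : ∀ l, acoef l ≤ amax)
    (c : UT N × Fin d → ℝ) {cmin cmax : ℝ} (hcmin : 0 < cmin) (hc_lo : ∀ b, cmin ≤ |c b|) (hc_hi : ∀ b, |c b| ≤ cmax)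
    (α : Cell s L Λ → ℝ) (hα : ∀ k, 0 ≤ α k) {α₀ : ℝ} (hαS : ∀ k, (side s L (lvl k) : ℝ) ^ 2 * α k ≤ α₀)
    (hplaq : ∀ (k : Cell s L Λ) (v : Box d (side s L (lvl k))) (κ μ : Fin d) (hκ : (v κ : ℕ) + 1 < side s L (lvl k))
      (hμ : (v μ : ℕ) + 1 < side s L (lvl k)), κ ≠ μ →
        ‖cpxHom (cellPlaq (side s L) (side_pos hs hL) (side_dvd hdiv) lvl (zc hs hL hdiv) Rm k v κ μ hκ hμ) - 1‖ ≤ α k)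
    {κ : ℝ} (hκ0 : 0 ≤ κ) (hκ1 : κ ≤ 1)
    (hμ : 0 < (1 - 8 * (d : ℝ) ^ 4 * α₀ ^ 2) * min (cmin ^ 2 / (4 * d)) (amin / 4) - 2 * d * cmax ^ 2 * κ ^ 2 -
      amax * (Real.exp (2 * d * κ) - 1))
    (P : Matrix (UT N × Cp) (UT N × Cp) ℂ) (hP : ∀ z, 0 ≤ (star z ⬝ᵥ (P *ᵥ z)).re) {θ : ℝ} (hθ : θ < 1)
    (hJ : ∀ q e : UT N × Cp,
      (expRowDefect P κ (fun e => sdist bsrc btgt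
          (siteScale (side s L) (side_pos hs hL) (side_dvd hdiv) lvl (zc hs hL hdiv) (cells_cover (Λ := Λ) hs hL hdiv)) e.1 q.1) e +
        expColDefect P κ (fun e => sdist bsrc btgt
          (siteScale (side s L) (side_pos hs hL) (side_dvd hdiv) lvl (zc hs hL hdiv) (cells_cover (Λ := Λ) hs hL hdiv)) e.1 q.1) e) / 2 ≤
        θ * (((1 - 8 * (d : ℝ) ^ 4 * α₀ ^ 2) * min (cmin ^ 2 / (4 * d)) (amin / 4) - 2 * d * cmax ^ 2 * κ ^ 2 -
            amax * (Real.exp (2 * d * κ) - 1)) *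
          ((siteScale (side s L) (side_pos hs hL) (side_dvd hdiv) lvl (zc hs hL hdiv) (cells_cover (Λ := Λ) hs hL hdiv) e.1 : ℝ) ^ 2)⁻¹))
    (cc b' : Cell s L Λ) :
    ‖Matrix.toEuclideanCLM (n := UT N × Cp) (𝕜 := ℂ)
        (Matrix.of fun p q : UT N × Cp =>
          if cellOf (side s L) (side_pos hs hL) (side_dvd hdiv) lvl (zc hs hL hdiv) (cells_cover (Λ := Λ) hs hL hdiv) p.1 = cc ∧
              cellOf (side s L) (side_pos hs hL) (side_dvd hdiv) lvl (zc hs hL hdiv) (cells_cover (Λ := Λ) hs hL hdiv) q.1 = b' then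
            ((cmat (levelOp bsrc btgt c Rm (fun l x => ctrU N (side s L l) (tblk (side_pos hs hL l) (side_dvd hdiv l) x))
              (fun l x => meanProfile hs hL hdiv Λ l (ctrU N (side s L l) (tblk (side_pos hs hL l) (side_dvd hdiv l) x)))
              (fun l x => (torusComb (side_pos hs hL l) (side_dvd hdiv l)).tr Rm x) (treeWeight d s L acoef)) + P)⁻¹) p q
          else 0)‖ ≤
      (Real.exp (4 * d * κ) * ((L * s : ℕ) : ℝ) ^ 2 /
          ((1 - θ) * ((1 - 8 * (d : ℝ) ^ 4 * α₀ ^ 2) * min (cmin ^ 2 / (4 * d)) (amin / 4) - 2 * d * cmax ^ 2 * κ ^ 2 -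
            amax * (Real.exp (2 * d * κ) - 1)))) *
        Real.exp (-(κ * sdist bsrc btgt
          (siteScale (side s L) (side_pos hs hL) (side_dvd hdiv) lvl (zc hs hL hdiv) (cells_cover (Λ := Λ) hs hL hdiv))
          (ctrU N (side s L (lvl cc)) (zc hs hL hdiv cc)) (ctrU N (side s L (lvl b')) (zc hs hL hdiv b')))) := by
  classical
  set μ₀ := (1 - 8 * (d : ℝ) ^ 4 * α₀ ^ 2) * min (cmin ^ 2 / (4 * d)) (amin / 4) - 2 * d * cmax ^ 2 * κ ^ 2 -
    amax * (Real.exp (2 * d * κ) - 1) with hμ₀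
  set n := siteScale (side s L) (side_pos hs hL) (side_dvd hdiv) lvl (zc hs hL hdiv) (cells_cover (Λ := Λ) hs hL hdiv) with hn
  set A := (cmat (levelOp bsrc btgt c Rm (fun l x => ctrU N (side s L l) (tblk (side_pos hs hL l) (side_dvd hdiv l) x))
    (fun l x => meanProfile hs hL hdiv Λ l (ctrU N (side s L l) (tblk (side_pos hs hL l) (side_dvd hdiv l) x)))
    (fun l x => (torusComb (side_pos hs hL l) (side_dvd hdiv l)).tr Rm x) (treeWeight d s L acoef)) + P)⁻¹ with hA
  set sd := sdist bsrc btgt n (ctrU N (side s L (lvl cc)) (zc hs hL hdiv cc)) (ctrU N (side s L (lvl b')) (zc hs hL hdiv b')) with hsd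
  set Xc : Finset (UT N × Cp) := univ.filter (fun p => cellOf (side s L) (side_pos hs hL) (side_dvd hdiv) lvl (zc hs hL hdiv)
    (cells_cover (Λ := Λ) hs hL hdiv) p.1 = cc) with hXc
  set Xb : Finset (UT N × Cp) := univ.filter (fun p => cellOf (side s L) (side_pos hs hL) (side_dvd hdiv) lvl (zc hs hL hdiv)
    (cells_cover (Λ := Λ) hs hL hdiv) p.1 = b') with hXb
  have h1θ : 0 < 1 - θ := by linarith
  have hSpos : ∀ k : Cell s L Λ, (0 : ℝ) < (side s L (lvl k) : ℝ) := fun k => by exact_mod_cast side_pos hs hL (lvl k)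
  have hSmax : ∀ k : Cell s L Λ, (side s L (lvl k) : ℝ) ≤ ((L * s : ℕ) : ℝ) := fun k => side_le_coarse hL (lvl k)
  have hSmax0 : (0 : ℝ) < ((L * s : ℕ) : ℝ) := (hSpos cc).trans_le (hSmax cc)
  have hν : ∀ k : Cell s L Λ, 0 < (1 - θ) * μ₀ * ((side s L (lvl k) : ℝ) ^ 2)⁻¹ := fun k =>
    mul_pos (mul_pos h1θ hμ) (inv_pos.mpr (pow_pos (hSpos k) 2))
  -- the Beta∕S121 END's constant and its uniform majorant
  set B : ℝ := Real.exp (-(κ * (sd - 2 * d - 2 * d))) /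
      Real.sqrt ((1 - θ) * μ₀ * ((side s L (lvl cc) : ℝ) ^ 2)⁻¹ * ((1 - θ) * μ₀ * ((side s L (lvl b') : ℝ) ^ 2)⁻¹)) with hB
  have hden : 0 < Real.sqrt ((1 - θ) * μ₀ * ((side s L (lvl cc) : ℝ) ^ 2)⁻¹ * ((1 - θ) * μ₀ * ((side s L (lvl b') : ℝ) ^ 2)⁻¹)) :=
    Real.sqrt_pos.mpr (mul_pos (hν cc) (hν b'))
  have hB0 : 0 ≤ B := div_nonneg (Real.exp_pos _).le hden.le
  -- the block bound from §1 + S121 f4 (coercivity via S119 f1's gauge)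
  have hblock : ‖Matrix.toEuclideanCLM (n := UT N × Cp) (𝕜 := ℂ)
      (Matrix.of fun p q : UT N × Cp => if p ∈ Xc ∧ q ∈ Xb then A p q else 0)‖ ≤ B := by
    refine opNorm_toEuclideanCLM_block_le_of_sqrt A Xc Xb hB0 fun v hv => ?_
    have hv' : ∀ p : UT N × Cp, cellOf (side s L) (side_pos hs hL) (side_dvd hdiv) lvl (zc hs hL hdiv)
        (cells_cover (Λ := Λ) hs hL hdiv) p.1 ≠ b' → v p = 0 := fun p hp => hv p (fun hmem => hp (mem_filter.mp hmem).2)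
    have h := cellNorm_inv_add_complexRay_le (side s L) (side_pos hs hL) (side_dvd hdiv) lvl (zc hs hL hdiv) (cells_disjoint hs hL hdiv)
      (cells_cover hs hL hdiv) Rm hRm (fun l x => (torusComb (side_pos hs hL l) (side_dvd hdiv l)).tr Rm x)
      (fun l x i i' => (torusComb (side_pos hs hL l) (side_dvd hdiv l)).tr_orth Rm hRm x i i') (treeWeight d s L acoef)
      (treeWeight_nonneg fun l => hamin.trans (ha_lo l)) (meanProfile hs hL hdiv Λ) (meanProfile_supp hs hL hdiv)
      (hamin.trans ((ha_lo true).trans (ha_hi true))) (scale_hi hs hL hdiv ha_hi) c hc_hi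
      (fun f => multiscale_coercive_torus_cov (Nat.one_le_iff_ne_zero.mpr (NeZero.ne d)) (side s L) (side_pos hs hL) (side_dvd hdiv)
        Rm hRm (treeWeight d s L acoef) (treeWeight_nonneg fun l => hamin.trans (ha_lo l)) (meanProfile hs hL hdiv Λ) c hcmin hc_lo
        lvl (zc hs hL hdiv) (cells_disjoint hs hL hdiv) hamin (scale_lo hs hL hdiv ha_lo)
        (cellGauge (side s L) (side_pos hs hL) (side_dvd hdiv) lvl (zc hs hL hdiv) Rm hRm)
        (cellGauge_orth (side s L) (side_pos hs hL) (side_dvd hdiv) lvl (zc hs hL hdiv) Rm hRm)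
        (fun k => d * ((side s L (lvl k) : ℝ) - 1) * α k)
        (fun k => by
          have hs1 : (1 : ℝ) ≤ side s L (lvl k) := by exact_mod_cast side_pos hs hL (lvl k)
          have := hα k
          have : (0 : ℝ) ≤ (side s L (lvl k) : ℝ) - 1 := by linarith
          positivity)
        (fun k v i hv u => hgauge_of_plaquettes (side s L) (side_pos hs hL) (side_dvd hdiv) lvl (zc hs hL hdiv) Rm hRm k (hα k)
          (hplaq k) v i hv u)
        (fun k => hloss_of_plaquettes (side s L) (side_pos hs hL) lvl α hα hαS k) f)
      hκ0 hκ1 hμ P hP hθ hJ cc b' v hv'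
    rw [hB, hXc, hXb, hA]
    exact h
  have hmat : (Matrix.of fun p q : UT N × Cp =>
      if cellOf (side s L) (side_pos hs hL) (side_dvd hdiv) lvl (zc hs hL hdiv) (cells_cover (Λ := Λ) hs hL hdiv) p.1 = cc ∧
          cellOf (side s L) (side_pos hs hL) (side_dvd hdiv) lvl (zc hs hL hdiv) (cells_cover (Λ := Λ) hs hL hdiv) q.1 = b' then A p q
      else 0) = (Matrix.of fun p q : UT N × Cp => if p ∈ Xc ∧ q ∈ Xb then A p q else 0) := by
    ext p q
    simp only [Matrix.of_apply, hXc, hXb, mem_filter, mem_univ, true_and]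
  rw [hmat]
  refine hblock.trans ?_
  -- `B ≤ c𝒢 · e^{−κ·sd}`
  have hexp : Real.exp (-(κ * (sd - 2 * d - 2 * d))) = Real.exp (4 * d * κ) * Real.exp (-(κ * sd)) := by
    rw [← Real.exp_add]; ring_nf
  have hμS : 0 < (1 - θ) * μ₀ / ((L * s : ℕ) : ℝ) ^ 2 := by positivity
  have hsqrt_ge : (1 - θ) * μ₀ / ((L * s : ℕ) : ℝ) ^ 2 ≤
      Real.sqrt ((1 - θ) * μ₀ * ((side s L (lvl cc) : ℝ) ^ 2)⁻¹ * ((1 - θ) * μ₀ * ((side s L (lvl b') : ℝ) ^ 2)⁻¹)) := by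
    have hk : ∀ k : Cell s L Λ, (1 - θ) * μ₀ / ((L * s : ℕ) : ℝ) ^ 2 ≤ (1 - θ) * μ₀ * ((side s L (lvl k) : ℝ) ^ 2)⁻¹ := fun k => by
      rw [div_eq_mul_inv]
      exact mul_le_mul_of_nonneg_left (inv_anti₀ (pow_pos (hSpos k) 2) (pow_le_pow_left₀ (hSpos k).le (hSmax k) 2))
        (mul_pos h1θ hμ).le
    calc (1 - θ) * μ₀ / ((L * s : ℕ) : ℝ) ^ 2
        = Real.sqrt (((1 - θ) * μ₀ / ((L * s : ℕ) : ℝ) ^ 2) * ((1 - θ) * μ₀ / ((L * s : ℕ) : ℝ) ^ 2)) :=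
          (Real.sqrt_mul_self hμS.le).symm
      _ ≤ _ := Real.sqrt_le_sqrt (mul_le_mul (hk cc) (hk b') hμS.le (hν cc).le)
  calc B = Real.exp (4 * d * κ) * Real.exp (-(κ * sd)) /
        Real.sqrt ((1 - θ) * μ₀ * ((side s L (lvl cc) : ℝ) ^ 2)⁻¹ * ((1 - θ) * μ₀ * ((side s L (lvl b') : ℝ) ^ 2)⁻¹)) := by
          rw [hB, hexp]
    _ ≤ Real.exp (4 * d * κ) * Real.exp (-(κ * sd)) / ((1 - θ) * μ₀ / ((L * s : ℕ) : ℝ) ^ 2) :=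
        div_le_div_of_nonneg_left (by positivity) hμS hsqrt_ge
    _ = Real.exp (4 * d * κ) * ((L * s : ℕ) : ℝ) ^ 2 / ((1 - θ) * μ₀) * Real.exp (-(κ * sd)) := by
        field_simp

/-! ## §3 (E1) along the complex ray -/

/-- **(E1) ALONG THE COMPLEX RAY, FROM (E6) + f1's VOLUME-FREE ROW SUM** (S66 f3a `opNorm_kerOp_le` BY NAME): under the hypotheses of
§2 and f1 §2 (graded sizes `s = L^j`, `ε, R > 0`, rate condition `e^{ε + 2(log L∕R)d}·e^{−κ} < 1`),
`‖kerOp blockP‖ ≤ (e^{4dκ}(L·s)²∕((1−θ)μ₀))·N₀Λ∕(1 − Λe^{−κ})`. [folklore] -/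
theorem opNorm_kerOp_complexRay_slot_of_plaquettes {j : ℕ} (hsj : s = L ^ j)
    (Rm : UT N × Fin d → Cp → Cp → ℝ) (hRm : ∀ b i j, ∑ k, Rm b k i * Rm b k j = if i = j then (1 : ℝ) else 0)
    {acoef : Bool → ℝ} {amin amax : ℝ} (hamin : 0 ≤ amin) (ha_lo : ∀ l, amin ≤ acoef l) (ha_hi : ∀ l, acoef l ≤ amax)
    (c : UT N × Fin d → ℝ) {cmin cmax : ℝ} (hcmin : 0 < cmin) (hc_lo : ∀ b, cmin ≤ |c b|) (hc_hi : ∀ b, |c b| ≤ cmax)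
    (α : Cell s L Λ → ℝ) (hα : ∀ k, 0 ≤ α k) {α₀ : ℝ} (hαS : ∀ k, (side s L (lvl k) : ℝ) ^ 2 * α k ≤ α₀)
    (hplaq : ∀ (k : Cell s L Λ) (v : Box d (side s L (lvl k))) (κ μ : Fin d) (hκ : (v κ : ℕ) + 1 < side s L (lvl k))
      (hμ : (v μ : ℕ) + 1 < side s L (lvl k)), κ ≠ μ →
        ‖cpxHom (cellPlaq (side s L) (side_pos hs hL) (side_dvd hdiv) lvl (zc hs hL hdiv) Rm k v κ μ hκ hμ) - 1‖ ≤ α k)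
    {κ : ℝ} (hκ0 : 0 ≤ κ) (hκ1 : κ ≤ 1)
    (hμ : 0 < (1 - 8 * (d : ℝ) ^ 4 * α₀ ^ 2) * min (cmin ^ 2 / (4 * d)) (amin / 4) - 2 * d * cmax ^ 2 * κ ^ 2 -
      amax * (Real.exp (2 * d * κ) - 1))
    (P : Matrix (UT N × Cp) (UT N × Cp) ℂ) (hP : ∀ z, 0 ≤ (star z ⬝ᵥ (P *ᵥ z)).re) {θ : ℝ} (hθ : θ < 1)
    (hJ : ∀ q e : UT N × Cp,
      (expRowDefect P κ (fun e => sdist bsrc btgt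
          (siteScale (side s L) (side_pos hs hL) (side_dvd hdiv) lvl (zc hs hL hdiv) (cells_cover (Λ := Λ) hs hL hdiv)) e.1 q.1) e +
        expColDefect P κ (fun e => sdist bsrc btgt
          (siteScale (side s L) (side_pos hs hL) (side_dvd hdiv) lvl (zc hs hL hdiv) (cells_cover (Λ := Λ) hs hL hdiv)) e.1 q.1) e) / 2 ≤
        θ * (((1 - 8 * (d : ℝ) ^ 4 * α₀ ^ 2) * min (cmin ^ 2 / (4 * d)) (amin / 4) - 2 * d * cmax ^ 2 * κ ^ 2 -
            amax * (Real.exp (2 * d * κ) - 1)) *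
          ((siteScale (side s L) (side_pos hs hL) (side_dvd hdiv) lvl (zc hs hL hdiv) (cells_cover (Λ := Λ) hs hL hdiv) e.1 : ℝ) ^ 2)⁻¹))
    {ε R : ℝ} (hε : 0 < ε) (hR : 0 < R) (hq : Real.exp (ε + 2 * (Real.log L / R) * d) * Real.exp (-κ) < 1) :
    ‖kerOp (𝕜 := ℂ) (fun cc b' : Cell s L Λ => Matrix.toEuclideanCLM (n := UT N × Cp) (𝕜 := ℂ)
        (Matrix.of fun p q : UT N × Cp =>
          if cellOf (side s L) (side_pos hs hL) (side_dvd hdiv) lvl (zc hs hL hdiv) (cells_cover (Λ := Λ) hs hL hdiv) p.1 = cc ∧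
              cellOf (side s L) (side_pos hs hL) (side_dvd hdiv) lvl (zc hs hL hdiv) (cells_cover (Λ := Λ) hs hL hdiv) q.1 = b' then
            ((cmat (levelOp bsrc btgt c Rm (fun l x => ctrU N (side s L l) (tblk (side_pos hs hL l) (side_dvd hdiv l) x))
              (fun l x => meanProfile hs hL hdiv Λ l (ctrU N (side s L l) (tblk (side_pos hs hL l) (side_dvd hdiv l) x)))
              (fun l x => (torusComb (side_pos hs hL l) (side_dvd hdiv l)).tr Rm x) (treeWeight d s L acoef)) + P)⁻¹) p q
          else 0))‖ ≤
      Real.exp (4 * d * κ) * ((L * s : ℕ) : ℝ) ^ 2 /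
          ((1 - θ) * ((1 - 8 * (d : ℝ) ^ 4 * α₀ ^ 2) * min (cmin ^ 2 / (4 * d)) (amin / 4) - 2 * d * cmax ^ 2 * κ ^ 2 -
            amax * (Real.exp (2 * d * κ) - 1))) *
        ((3 * ((L : ℝ) ^ (1 : ℕ)) ^ 2) ^ d * ((d.factorial : ℝ) / ε ^ d) * Real.exp (2 * d * (ε + Real.log L / R * d)) *
            Real.exp (ε + 2 * (Real.log L / R) * d) /
          (1 - Real.exp (ε + 2 * (Real.log L / R) * d) * Real.exp (-κ))) := by
  have h1θ : 0 < 1 - θ := by linarith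
  have hC : 0 ≤ Real.exp (4 * d * κ) * ((L * s : ℕ) : ℝ) ^ 2 /
      ((1 - θ) * ((1 - 8 * (d : ℝ) ^ 4 * α₀ ^ 2) * min (cmin ^ 2 / (4 * d)) (amin / 4) - 2 * d * cmax ^ 2 * κ ^ 2 -
        amax * (Real.exp (2 * d * κ) - 1))) := by positivity
  have hq1 : 0 < 1 - Real.exp (ε + 2 * (Real.log L / R) * d) * Real.exp (-κ) := by linarith
  have hM : 0 ≤ (3 * ((L : ℝ) ^ (1 : ℕ)) ^ 2) ^ d * ((d.factorial : ℝ) / ε ^ d) * Real.exp (2 * d * (ε + Real.log L / R * d)) *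
      Real.exp (ε + 2 * (Real.log L / R) * d) / (1 - Real.exp (ε + 2 * (Real.log L / R) * d) * Real.exp (-κ)) := by positivity
  refine opNorm_kerOp_le _ (mul_nonneg hC hM) fun cc => ?_
  calc _ ≤ ∑ b' : Cell s L Λ, Real.exp (4 * d * κ) * ((L * s : ℕ) : ℝ) ^ 2 /
            ((1 - θ) * ((1 - 8 * (d : ℝ) ^ 4 * α₀ ^ 2) * min (cmin ^ 2 / (4 * d)) (amin / 4) - 2 * d * cmax ^ 2 * κ ^ 2 -
              amax * (Real.exp (2 * d * κ) - 1))) *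
          Real.exp (-(κ * sdist bsrc btgt
            (siteScale (side s L) (side_pos hs hL) (side_dvd hdiv) lvl (zc hs hL hdiv) (cells_cover (Λ := Λ) hs hL hdiv))
            (ctrU N (side s L (lvl cc)) (zc hs hL hdiv cc)) (ctrU N (side s L (lvl b')) (zc hs hL hdiv b')))) :=
        Finset.sum_le_sum fun b' _ => decayRow_complexRay_slot_of_plaquettes hs hL hdiv Rm hRm hamin ha_lo ha_hi c hcmin hc_lo hc_hi
          α hα hαS hplaq hκ0 hκ1 hμ P hP hθ hJ cc b'
    _ = Real.exp (4 * d * κ) * ((L * s : ℕ) : ℝ) ^ 2 /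
            ((1 - θ) * ((1 - 8 * (d : ℝ) ^ 4 * α₀ ^ 2) * min (cmin ^ 2 / (4 * d)) (amin / 4) - 2 * d * cmax ^ 2 * κ ^ 2 -
              amax * (Real.exp (2 * d * κ) - 1))) *
          ∑ b' : Cell s L Λ, Real.exp (-(κ * sdist bsrc btgt
            (siteScale (side s L) (side_pos hs hL) (side_dvd hdiv) lvl (zc hs hL hdiv) (cells_cover (Λ := Λ) hs hL hdiv))
            (ctrU N (side s L (lvl cc)) (zc hs hL hdiv cc)) (ctrU N (side s L (lvl b')) (zc hs hL hdiv b')))) := by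
        rw [Finset.mul_sum]
    _ ≤ _ := mul_le_mul_of_nonneg_left (rowSum_sdist_slot hs hL hdiv hsj hε hR hκ0 hq cc) hC

/-- **(E1) ALONG THE COMPLEX RAY, POINTWISE — `∀ f, ‖kerOp blockP f‖ ≤ B₀·‖f‖`** (one `le_opNorm` line over §3). [folklore] -/
theorem norm_kerOp_complexRay_slot_apply_le {j : ℕ} (hsj : s = L ^ j)
    (Rm : UT N × Fin d → Cp → Cp → ℝ) (hRm : ∀ b i j, ∑ k, Rm b k i * Rm b k j = if i = j then (1 : ℝ) else 0)
    {acoef : Bool → ℝ} {amin amax : ℝ} (hamin : 0 ≤ amin) (ha_lo : ∀ l, amin ≤ acoef l) (ha_hi : ∀ l, acoef l ≤ amax)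
    (c : UT N × Fin d → ℝ) {cmin cmax : ℝ} (hcmin : 0 < cmin) (hc_lo : ∀ b, cmin ≤ |c b|) (hc_hi : ∀ b, |c b| ≤ cmax)
    (α : Cell s L Λ → ℝ) (hα : ∀ k, 0 ≤ α k) {α₀ : ℝ} (hαS : ∀ k, (side s L (lvl k) : ℝ) ^ 2 * α k ≤ α₀)
    (hplaq : ∀ (k : Cell s L Λ) (v : Box d (side s L (lvl k))) (κ μ : Fin d) (hκ : (v κ : ℕ) + 1 < side s L (lvl k))
      (hμ : (v μ : ℕ) + 1 < side s L (lvl k)), κ ≠ μ →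
        ‖cpxHom (cellPlaq (side s L) (side_pos hs hL) (side_dvd hdiv) lvl (zc hs hL hdiv) Rm k v κ μ hκ hμ) - 1‖ ≤ α k)
    {κ : ℝ} (hκ0 : 0 ≤ κ) (hκ1 : κ ≤ 1)
    (hμ : 0 < (1 - 8 * (d : ℝ) ^ 4 * α₀ ^ 2) * min (cmin ^ 2 / (4 * d)) (amin / 4) - 2 * d * cmax ^ 2 * κ ^ 2 -
      amax * (Real.exp (2 * d * κ) - 1))
    (P : Matrix (UT N × Cp) (UT N × Cp) ℂ) (hP : ∀ z, 0 ≤ (star z ⬝ᵥ (P *ᵥ z)).re) {θ : ℝ} (hθ : θ < 1)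
    (hJ : ∀ q e : UT N × Cp,
      (expRowDefect P κ (fun e => sdist bsrc btgt
          (siteScale (side s L) (side_pos hs hL) (side_dvd hdiv) lvl (zc hs hL hdiv) (cells_cover (Λ := Λ) hs hL hdiv)) e.1 q.1) e +
        expColDefect P κ (fun e => sdist bsrc btgt
          (siteScale (side s L) (side_pos hs hL) (side_dvd hdiv) lvl (zc hs hL hdiv) (cells_cover (Λ := Λ) hs hL hdiv)) e.1 q.1) e) / 2 ≤
        θ * (((1 - 8 * (d : ℝ) ^ 4 * α₀ ^ 2) * min (cmin ^ 2 / (4 * d)) (amin / 4) - 2 * d * cmax ^ 2 * κ ^ 2 -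
            amax * (Real.exp (2 * d * κ) - 1)) *
          ((siteScale (side s L) (side_pos hs hL) (side_dvd hdiv) lvl (zc hs hL hdiv) (cells_cover (Λ := Λ) hs hL hdiv) e.1 : ℝ) ^ 2)⁻¹))
    {ε R : ℝ} (hε : 0 < ε) (hR : 0 < R) (hq : Real.exp (ε + 2 * (Real.log L / R) * d) * Real.exp (-κ) < 1)
    (f : Cell s L Λ → EuclideanSpace ℂ (UT N × Cp)) :
    ‖kerOp (𝕜 := ℂ) (fun cc b' : Cell s L Λ => Matrix.toEuclideanCLM (n := UT N × Cp) (𝕜 := ℂ)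
        (Matrix.of fun p q : UT N × Cp =>
          if cellOf (side s L) (side_pos hs hL) (side_dvd hdiv) lvl (zc hs hL hdiv) (cells_cover (Λ := Λ) hs hL hdiv) p.1 = cc ∧
              cellOf (side s L) (side_pos hs hL) (side_dvd hdiv) lvl (zc hs hL hdiv) (cells_cover (Λ := Λ) hs hL hdiv) q.1 = b' then
            ((cmat (levelOp bsrc btgt c Rm (fun l x => ctrU N (side s L l) (tblk (side_pos hs hL l) (side_dvd hdiv l) x))
              (fun l x => meanProfile hs hL hdiv Λ l (ctrU N (side s L l) (tblk (side_pos hs hL l) (side_dvd hdiv l) x)))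
              (fun l x => (torusComb (side_pos hs hL l) (side_dvd hdiv l)).tr Rm x) (treeWeight d s L acoef)) + P)⁻¹) p q
          else 0)) f‖ ≤
      Real.exp (4 * d * κ) * ((L * s : ℕ) : ℝ) ^ 2 /
          ((1 - θ) * ((1 - 8 * (d : ℝ) ^ 4 * α₀ ^ 2) * min (cmin ^ 2 / (4 * d)) (amin / 4) - 2 * d * cmax ^ 2 * κ ^ 2 -
            amax * (Real.exp (2 * d * κ) - 1))) *
        ((3 * ((L : ℝ) ^ (1 : ℕ)) ^ 2) ^ d * ((d.factorial : ℝ) / ε ^ d) * Real.exp (2 * d * (ε + Real.log L / R * d)) *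
            Real.exp (ε + 2 * (Real.log L / R) * d) /
          (1 - Real.exp (ε + 2 * (Real.log L / R) * d) * Real.exp (-κ))) * ‖f‖ :=
  (ContinuousLinearMap.le_opNorm _ f).trans (mul_le_mul_of_nonneg_right
    (opNorm_kerOp_complexRay_slot_of_plaquettes hs hL hdiv hsj Rm hRm hamin ha_lo ha_hi c hcmin hc_lo hc_hi α hα hαS hplaq hκ0 hκ1
      hμ P hP hθ hJ hε hR hq) (norm_nonneg f))

/-! ## §4 RULE G-1: the real point of the ray (`P = 0`, `θ = 0`) on f1's `d = 4` family -/

omit [NeZero d] [∀ i, NeZero (N i)] [Nonempty Cp] [Fintype Cp] [DecidableEq Cp] in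
/-- the zero remainder has zero exponential row∕column defects. [folklore] -/
theorem expDefect_zero {ι : Type*} [Fintype ι] (κ : ℝ) (ρ : ι → ℝ) (e : ι) :
    expRowDefect (0 : Matrix ι ι ℂ) κ ρ e = 0 ∧ expColDefect (0 : Matrix ι ι ℂ) κ ρ e = 0 := by
  simp [expRowDefect, expColDefect]

/-- **RULE G-1, (E6) complex ray**: FIRES on the `d = 4` slot family (torus `4⁴`, `s = 1`, `L = 2`, ANY slot, fibre `Unit`, `c ≡ 1`,
`acoef ≡ 1`, `κ = 10⁻³`) at the flat background with the ZERO remainder (`P = 0`, `θ = 0`) — every hypothesis discharged. [folklore] -/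
example (Λ : Finset (Ctr (fun _ : Fin 4 => 4) (2 * 1))) (cc b' : Cell 1 2 Λ) :=
  decayRow_complexRay_slot_of_plaquettes (Cp := Unit) (Λ := Λ) le_rfl (by norm_num) (fun _ => ⟨2, rfl⟩) (fun _ => oneM)
    (fun _ i j => oneM_orth i j) (acoef := fun _ => 1) (amin := 1) (amax := 1) zero_le_one (fun _ => le_rfl) (fun _ => le_rfl)
    (fun _ => 1) (cmin := 1) (cmax := 1) one_pos (fun _ => by simp) (fun _ => by simp) (fun _ => 0) (fun _ => le_rfl) (α₀ := 0)
    (fun _ => by simp) (fun k v κ μ hκ hμ _ => norm_cellPlaq_flat_sub_one k v κ μ hκ hμ) (κ := 1 / 1000) (by norm_num) (by norm_num)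
    mu0_pos_d4 0 (fun z => by simp) (θ := 0) zero_lt_one
    (fun q e => by rw [(expDefect_zero _ _ e).1, (expDefect_zero _ _ e).2]; simp) cc b'

/-- **RULE G-1, (E1) complex ray**: the bounded kernel operator FIRES on the same data (`ε = 10⁻⁴`, `R = 10⁵`). [folklore] -/
example (Λ : Finset (Ctr (fun _ : Fin 4 => 4) (2 * 1))) :=
  opNorm_kerOp_complexRay_slot_of_plaquettes (Cp := Unit) (Λ := Λ) le_rfl (by norm_num) (fun _ => ⟨2, rfl⟩) (j := 0) (by norm_num)
    (fun _ => oneM) (fun _ i j => oneM_orth i j) (acoef := fun _ => 1) (amin := 1) (amax := 1) zero_le_one (fun _ => le_rfl)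
    (fun _ => le_rfl) (fun _ => 1) (cmin := 1) (cmax := 1) one_pos (fun _ => by simp) (fun _ => by simp) (fun _ => 0)
    (fun _ => le_rfl) (α₀ := 0) (fun _ => by simp) (fun k v κ μ hκ hμ _ => norm_cellPlaq_flat_sub_one k v κ μ hκ hμ)
    (κ := 1 / 1000) (by norm_num) (by norm_num) mu0_pos_d4 0 (fun z => by simp) (θ := 0) zero_lt_one
    (fun q e => by rw [(expDefect_zero _ _ e).1, (expDefect_zero _ _ e).2]; simp) (ε := 1 / 10000) (R := 100000) (by norm_num)
    (by norm_num) rate_d4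

end Slot

end Summit.QuantumFields.BalabanUV.T4Continuum.ShellMeasureDecayRowsModelEndComplexRay

end
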